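import Summits.QuantumFields.YangMills.Theorems.UnitScaleTiltProp7SkewSplitFrobeniusRow
import HarnessLib

/-!
# Route `UnitScaleTilt`, crux «MinimiserStabilityRegPr» (stmt-QuantumFields-19200), stub `stub_existenceMinimalOrbit` (EX), pen (b1) glue —
# **THE TRACE SPLIT `M₂(ℂ) = 𝔰𝔩₂ ⊕ ℂ·1` IS FROBENIUS-ORTHOGONAL: A COMPARISON ROW PROVED ON TRACELESS CARRIERS AND ON SCALAR CARRIERS HOLDS ON
# ALL (ANTI-HERMITIAN) CARRIERS WITH THE SAME CONSTANTS**

Cell `ym3-torus`, twin-width seat `ym-ust-19200-w7` (gen 10).  THEOREMS ONLY (0 `def`, 0 `sorry`); `--supports stmt-QuantumFields-19200 --as helper`, count-neutral.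
YM₃ on T³ is ladder rung R3 — NOT d = 4, NOT infinite volume, NOT a mass gap, NOT Clay; nothing here claims a print row, the stub or the crux.

WHY.  The companion of ✓`Prop7SkewSplitFrobeniusRow.row_of_skew_row` (𝔲(2) ⊕ i𝔲(2)): the (b1) suppliers through LEG ✓`Prop7QSymEqTrueLinIter…` and px13 g11's sequel
`…CoarseGaugeEqFrameResponseQTwS` are stated for 𝔰𝔲(2)-valued directions (`skewAdjoint` AND `trace = 0`), the scalar direction is the flat identity
(✓`Prop7SymAvgTwSym.QTwS_apply_smul_one_of_regPr`), and 𝔲(2) = 𝔰𝔲(2) ⊕ iℝ·1.  This file: `X = (X − ½tr X·1) + ½tr X·1`, `⟪M, μ·1⟫_F = 0` when `tr M = 0`, hence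
`‖M + μ·1‖_F² = ‖M‖_F² + ‖μ·1‖_F²`; for ℂ-linear maps of matrix fields preserving «traceless» and «scalar», a Frobenius row on traceless carriers plus the same row on scalar
carriers gives the row on every carrier of the class (§3), constants unchanged.  [Balaban1985Averaging] (18)–(20) p.21; [Balaban1985Variational] (51) p.286 (the 𝔰𝔲(2)∕scalar sectors).
-/

set_option autoImplicit false

noncomputable section

open scoped BigOperators ComplexConjugate InnerProductSpace Matrix

namespace Summit.QuantumFields.YangMills.Theorems.Prop7TraceSplitFrobeniusRow

open Summit.QuantumFields.YangMills.Theorems.Prop7SectET3HilbertLetters (W₂ frobEquiv inner_frobEquiv_symm)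

/-! ## §1 Traceless ⊥ scalar in the Frobenius pairing -/

/-- `⟪M, μ·1⟫_F = 0` when `tr M = 0` (the full-inner-product strengthening of ✓`Prop7QTwSectors.re_inner_frob_traceless_smul_one`, which states `re ⟪·,·⟫ = 0`).
[cite: Balaban1985Averaging, (18) p.21] -/
theorem inner_frob_smul_one_of_trace_eq_zero {M : Matrix (Fin 2) (Fin 2) ℂ} (hM : M.trace = 0) (μ : ℂ) :
    ⟪(frobEquiv.symm M : W₂), frobEquiv.symm (μ • (1 : Matrix (Fin 2) (Fin 2) ℂ))⟫_ℂ = 0 := by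
  rw [inner_frobEquiv_symm, Matrix.mul_smul, Matrix.mul_one, Matrix.trace_smul, Matrix.trace_conjTranspose, hM, star_zero, smul_zero]

/-- ★ **PYTHAGORAS ACROSS `𝔰𝔩₂ ⊕ ℂ·1`**: `‖M + μ·1‖_F² = ‖M‖_F² + ‖μ·1‖_F²` when `tr M = 0`. [cite: Balaban1985Averaging, (18)-(20) p.21] -/
theorem norm_sq_frob_add_smul_one_of_trace_eq_zero {M : Matrix (Fin 2) (Fin 2) ℂ} (hM : M.trace = 0) (μ : ℂ) :
    ‖(frobEquiv.symm (M + μ • (1 : Matrix (Fin 2) (Fin 2) ℂ)) : W₂)‖ ^ 2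
      = ‖(frobEquiv.symm M : W₂)‖ ^ 2 + ‖(frobEquiv.symm (μ • (1 : Matrix (Fin 2) (Fin 2) ℂ)) : W₂)‖ ^ 2 := by
  rw [map_add, @norm_add_sq ℂ, inner_frob_smul_one_of_trace_eq_zero hM μ]
  simp

/-! ## §2 The split `X = (X − ½·tr X·1) + ½·tr X·1` -/

/-- The traceless part is traceless (the `t := tr X` instance of ✓`Prop7NestedMeanParallelLiftDiagGauge.trace_sub_half_trace_smul_one`, kept local under a distinct name —
that module is outside this file's import cone). [cite: Balaban1985Variational, (51) p.286] -/
theorem trace_sub_half_trace_smul_one_self (X : Matrix (Fin 2) (Fin 2) ℂ) :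
    (X - ((2 : ℂ)⁻¹ * X.trace) • (1 : Matrix (Fin 2) (Fin 2) ℂ)).trace = 0 := by
  rw [Matrix.trace_sub, Matrix.trace_smul, Matrix.trace_one, Fintype.card_fin]
  simp only [smul_eq_mul, Nat.cast_ofNat]
  ring

/-- The traceless part of an anti-Hermitian matrix is anti-Hermitian. [cite: Balaban1985Variational, (51) p.286] -/
theorem conjTranspose_sub_half_trace_smul_one {X : Matrix (Fin 2) (Fin 2) ℂ} (hX : Xᴴ = -X) :
    (X - ((2 : ℂ)⁻¹ * X.trace) • (1 : Matrix (Fin 2) (Fin 2) ℂ))ᴴ = -(X - ((2 : ℂ)⁻¹ * X.trace) • (1 : Matrix (Fin 2) (Fin 2) ℂ)) := by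
  have htr : star X.trace = -X.trace := by rw [← Matrix.trace_conjTranspose, hX, Matrix.trace_neg]
  have h2 : star (2 : ℂ)⁻¹ = (2 : ℂ)⁻¹ := by simp
  rw [Matrix.conjTranspose_sub, Matrix.conjTranspose_smul, Matrix.conjTranspose_one, hX, star_mul, htr, h2, mul_comm (-X.trace), mul_neg, neg_smul,
    sub_neg_eq_add, neg_sub', sub_neg_eq_add]

/-- The scalar part of an anti-Hermitian matrix is anti-Hermitian. [cite: Balaban1985Variational, (51) p.286] -/
theorem conjTranspose_half_trace_smul_one {X : Matrix (Fin 2) (Fin 2) ℂ} (hX : Xᴴ = -X) :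
    (((2 : ℂ)⁻¹ * X.trace) • (1 : Matrix (Fin 2) (Fin 2) ℂ))ᴴ = -(((2 : ℂ)⁻¹ * X.trace) • (1 : Matrix (Fin 2) (Fin 2) ℂ)) := by
  have htr : star X.trace = -X.trace := by rw [← Matrix.trace_conjTranspose, hX, Matrix.trace_neg]
  have h2 : star (2 : ℂ)⁻¹ = (2 : ℂ)⁻¹ := by simp
  rw [Matrix.conjTranspose_smul, Matrix.conjTranspose_one, star_mul, htr, h2, mul_comm, mul_neg, neg_smul]

/-- ★ **THE SPLIT**: `X = (X − ½tr X·1) + ½tr X·1`. [cite: Balaban1985Variational, (51) p.286] -/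
theorem sub_half_trace_add (X : Matrix (Fin 2) (Fin 2) ℂ) :
    (X - ((2 : ℂ)⁻¹ * X.trace) • (1 : Matrix (Fin 2) (Fin 2) ℂ)) + ((2 : ℂ)⁻¹ * X.trace) • (1 : Matrix (Fin 2) (Fin 2) ℂ) = X :=
  sub_add_cancel X _

/-! ## §3 Trace-compatible ℂ-linear maps: rows extend from (traceless ⊕ scalar) to all carriers of a class -/

variable {β γ δ : Type*} [Fintype β] [Fintype γ] [Fintype δ]

omit [Fintype β] in
/-- ★★ **FROBENIUS PYTHAGORAS FOR A TRACE-COMPATIBLE MAP**: if `T` sends traceless fields to traceless values and scalar fields to scalar values, then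
`Σ_c‖T(A₀ + s·1) c‖_F² = Σ_c‖TA₀ c‖_F² + Σ_c‖T(s·1) c‖_F²` for traceless `A₀`. [cite: Balaban1985Averaging, (18)-(20) p.21] -/
theorem sum_norm_sq_frob_apply_add_scalar (T : (β → Matrix (Fin 2) (Fin 2) ℂ) →ₗ[ℂ] (γ → Matrix (Fin 2) (Fin 2) ℂ))
    (hT0 : ∀ X : β → Matrix (Fin 2) (Fin 2) ℂ, (∀ b, (X b).trace = 0) → ∀ c, (T X c).trace = 0)
    (hT1 : ∀ s : β → ℂ, ∀ c, ∃ μ : ℂ, T (fun b => s b • (1 : Matrix (Fin 2) (Fin 2) ℂ)) c = μ • (1 : Matrix (Fin 2) (Fin 2) ℂ))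
    {A₀ : β → Matrix (Fin 2) (Fin 2) ℂ} (hA₀ : ∀ b, (A₀ b).trace = 0) (s : β → ℂ) :
    ∑ c, ‖(frobEquiv.symm (T (A₀ + fun b => s b • (1 : Matrix (Fin 2) (Fin 2) ℂ)) c) : W₂)‖ ^ 2
      = ∑ c, ‖(frobEquiv.symm (T A₀ c) : W₂)‖ ^ 2 + ∑ c, ‖(frobEquiv.symm (T (fun b => s b • (1 : Matrix (Fin 2) (Fin 2) ℂ)) c) : W₂)‖ ^ 2 := by
  rw [← Finset.sum_add_distrib]
  refine Finset.sum_congr rfl fun c _ => ?_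
  obtain ⟨μ, hμ⟩ := hT1 s c
  rw [map_add, Pi.add_apply, hμ]
  exact norm_sq_frob_add_smul_one_of_trace_eq_zero (hT0 A₀ hA₀ c) μ

/-- ★★★ **A COMPARISON ROW ON TRACELESS ANTI-HERMITIAN CARRIERS ⊕ ON SCALAR ANTI-HERMITIAN CARRIERS HOLDS ON ALL ANTI-HERMITIAN CARRIERS** (same constants):
for trace-compatible ℂ-linear `T`, `Q` (traceless ↦ traceless, scalar ↦ scalar), the 𝔰𝔲(2) row and the iℝ·1 row add up, by Frobenius orthogonality of the split, to the 𝔲(2) row —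
which ✓`Prop7SkewSplitFrobeniusRow.row_of_skew_row` then reads on every `M₂(ℂ)` carrier. [cite: Balaban1985Averaging, (18)-(20) p.21; Balaban1985Variational, (51) p.286] -/
theorem skewRow_of_traceless_row_of_scalar_row (T : (β → Matrix (Fin 2) (Fin 2) ℂ) →ₗ[ℂ] (γ → Matrix (Fin 2) (Fin 2) ℂ))
    (Q : (β → Matrix (Fin 2) (Fin 2) ℂ) →ₗ[ℂ] (δ → Matrix (Fin 2) (Fin 2) ℂ))
    (hT0 : ∀ X : β → Matrix (Fin 2) (Fin 2) ℂ, (∀ b, (X b).trace = 0) → ∀ c, (T X c).trace = 0)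
    (hT1 : ∀ s : β → ℂ, ∀ c, ∃ μ : ℂ, T (fun b => s b • (1 : Matrix (Fin 2) (Fin 2) ℂ)) c = μ • (1 : Matrix (Fin 2) (Fin 2) ℂ))
    (hQ0 : ∀ X : β → Matrix (Fin 2) (Fin 2) ℂ, (∀ b, (X b).trace = 0) → ∀ d, (Q X d).trace = 0)
    (hQ1 : ∀ s : β → ℂ, ∀ d, ∃ μ : ℂ, Q (fun b => s b • (1 : Matrix (Fin 2) (Fin 2) ℂ)) d = μ • (1 : Matrix (Fin 2) (Fin 2) ℂ))
    (α βc : ℝ)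
    (hrow0 : ∀ A₀ : β → Matrix (Fin 2) (Fin 2) ℂ, (∀ b, (A₀ b)ᴴ = -A₀ b) → (∀ b, (A₀ b).trace = 0) →
      ∑ c, ‖(frobEquiv.symm (T A₀ c) : W₂)‖ ^ 2 ≤ α * ∑ d, ‖(frobEquiv.symm (Q A₀ d) : W₂)‖ ^ 2 + βc * ∑ b, ‖(frobEquiv.symm (A₀ b) : W₂)‖ ^ 2)
    (hrow1 : ∀ s : β → ℂ, (∀ b, star (s b) = -s b) →
      ∑ c, ‖(frobEquiv.symm (T (fun b => s b • (1 : Matrix (Fin 2) (Fin 2) ℂ)) c) : W₂)‖ ^ 2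
        ≤ α * ∑ d, ‖(frobEquiv.symm (Q (fun b => s b • (1 : Matrix (Fin 2) (Fin 2) ℂ)) d) : W₂)‖ ^ 2
          + βc * ∑ b, ‖(frobEquiv.symm (s b • (1 : Matrix (Fin 2) (Fin 2) ℂ)) : W₂)‖ ^ 2)
    (A : β → Matrix (Fin 2) (Fin 2) ℂ) (hA : ∀ b, (A b)ᴴ = -A b) :
    ∑ c, ‖(frobEquiv.symm (T A c) : W₂)‖ ^ 2 ≤ α * ∑ d, ‖(frobEquiv.symm (Q A d) : W₂)‖ ^ 2 + βc * ∑ b, ‖(frobEquiv.symm (A b) : W₂)‖ ^ 2 := by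
  -- the split of the carrier
  set s : β → ℂ := fun b => (2 : ℂ)⁻¹ * (A b).trace with hsdef
  set A₀ : β → Matrix (Fin 2) (Fin 2) ℂ := fun b => A b - s b • (1 : Matrix (Fin 2) (Fin 2) ℂ) with hA₀def
  have hA₀tr : ∀ b, (A₀ b).trace = 0 := fun b => trace_sub_half_trace_smul_one_self (A b)
  have hA₀sk : ∀ b, (A₀ b)ᴴ = -A₀ b := fun b => conjTranspose_sub_half_trace_smul_one (hA b)
  have hssk : ∀ b, star (s b) = -s b := by
    intro b
    have htr : star (A b).trace = -(A b).trace := by rw [← Matrix.trace_conjTranspose, hA b, Matrix.trace_neg]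
    have h2 : star (2 : ℂ)⁻¹ = (2 : ℂ)⁻¹ := by simp
    show star ((2 : ℂ)⁻¹ * (A b).trace) = -((2 : ℂ)⁻¹ * (A b).trace)
    rw [star_mul, htr, h2, mul_comm, mul_neg, neg_mul_eq_mul_neg, mul_comm]
  have hX : (A₀ + fun b => s b • (1 : Matrix (Fin 2) (Fin 2) ℂ)) = A := by funext b; exact sub_half_trace_add (A b)
  -- the identity map is trace-compatible: the carrier's own Pythagoras
  have hXsq : ∑ b, ‖(frobEquiv.symm (A b) : W₂)‖ ^ 2
      = ∑ b, ‖(frobEquiv.symm (A₀ b) : W₂)‖ ^ 2 + ∑ b, ‖(frobEquiv.symm (s b • (1 : Matrix (Fin 2) (Fin 2) ℂ)) : W₂)‖ ^ 2 := by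
    rw [← Finset.sum_add_distrib]
    refine Finset.sum_congr rfl fun b _ => ?_
    conv_lhs => rw [← sub_half_trace_add (A b)]
    exact norm_sq_frob_add_smul_one_of_trace_eq_zero (hA₀tr b) (s b)
  rw [← hX, sum_norm_sq_frob_apply_add_scalar T hT0 hT1 hA₀tr s, sum_norm_sq_frob_apply_add_scalar Q hQ0 hQ1 hA₀tr s, hX, hXsq, mul_add, mul_add]
  have h1 := hrow0 A₀ hA₀sk hA₀tr
  have h2 := hrow1 s hssk
  linarith

end Summit.QuantumFields.YangMills.Theorems.Prop7TraceSplitFrobeniusRow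

end
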